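import Mathlib
import Summits.AtomisticToContinuum.Crystallization.Theorems.ChargedEnergyGap.Negative.Unconditional
import Summits.AtomisticToContinuum.Crystallization.Theorems.PalmUnimodularRigidityUnimodularEnergyLowerBoundCluster
import Literature.MathematicalPhysics.StatisticalMechanics.LennardJonesClusters
import HarnessLib

/-! # Averaging integrals over ball centres — stub `stub_averagingIntegrals` of line `Sketch`, crux `LjLaminarWindows` (stmt-AtomisticToContinuum-6711)

Continuous averaging over ball centres `c ∈ ℝ³` with configuration-free weights, for a finite
`δ`-separated configuration `x : Fin N → ℝ³` and a radius `L ≥ 1`: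

* `∫ #{j : |x_j − c| ≤ L} dc = N · (4/3)πL³` (a sum of indicators of closed balls);
* `∫ #{j : L − 1 < |x_j − c| ≤ L + 1} dc = N · (4/3)π((L+1)³ − (L−1)³) ≤ 11πL²N` (shells);
* `∫ Σ_{j ≠ k, |x_j − c| ≤ L, |x_k − c| ≤ L} V_LJ(|x_j − x_k|) dc ≤ (4/3)πL³ · 2𝓔(x) + 530 δ⁻⁵L²N`
  (lenses: `vol B_L − vol(B_L(x_j) ∩ B_L(x_k)) ≤ 4πL²|x_j − x_k|` against the attractive tail
  `V_LJ(r) ≥ −r⁻⁶/6`, and the shell sum `Σ_{k ≠ j} |x_j − x_k|⁻⁵ ≤ 250 δ⁻⁵`),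

together with the integrability of the three integrands.  All `[folklore]`.
-/

noncomputable section

open scoped BigOperators
open MeasureTheory Metric Filter Topology
open Literature.MathematicalPhysics.StatisticalMechanics
open Summit.AtomisticToContinuum.Crystallization.Theorems.ChargedEnergyGapNegative

namespace Summit.AtomisticToContinuum.Crystallization.Theorems.LjLaminarWindowsSketch

/-! ### Volumes of balls and lenses in `ℝ³` -/

/-- The volume of a closed ball of radius `r ≥ 0` in `ℝ³` is `(4/3)πr³`. [folklore] -/
private theorem averaging_volumeReal_closedBall (z : E3) {r : ℝ} (hr : 0 ≤ r) :
    volume.real (closedBall z r) = 4 / 3 * Real.pi * r ^ 3 := by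
  rw [measureReal_def, EuclideanSpace.volume_closedBall_fin_three, ENNReal.toReal_mul,
    ENNReal.toReal_pow, ENNReal.toReal_ofReal hr, ENNReal.toReal_ofReal (by positivity)]
  ring

/-- **Lens bound.** `vol B(z,L) − vol(B(z,L) ∩ B(w,L)) ≤ 4πL²·|z − w|`: the ball
`B(z, L − |z − w|)` lies in the lens and `L³ − (L − r)³ ≤ 3L²r` for `0 ≤ r ≤ L`, while for
`r > L` already `(4/3)πL³ ≤ 4πL²r`. [folklore] -/
private theorem averaging_lens (z w : E3) {L : ℝ} (hL : 0 ≤ L) :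
    volume.real (closedBall z L) - volume.real (closedBall z L ∩ closedBall w L) ≤
      4 * Real.pi * L ^ 2 * dist z w := by
  have hI : 0 ≤ volume.real (closedBall z L ∩ closedBall w L) := measureReal_nonneg
  have hd : 0 ≤ dist z w := dist_nonneg
  rcases le_or_gt (dist z w) L with hr | hr
  · have hsub : closedBall z (L - dist z w) ⊆ closedBall z L ∩ closedBall w L :=
      Set.subset_inter (closedBall_subset_closedBall (sub_le_self _ hd))
        (closedBall_subset_closedBall' (by linarith))
    have hmono : volume.real (closedBall z (L - dist z w)) ≤
        volume.real (closedBall z L ∩ closedBall w L) :=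
      measureReal_mono hsub (measure_ne_top_of_subset Set.inter_subset_left
        measure_closedBall_lt_top.ne)
    rw [averaging_volumeReal_closedBall z (sub_nonneg.2 hr)] at hmono
    rw [averaging_volumeReal_closedBall z hL]
    have key : 0 ≤ Real.pi * (dist z w ^ 2 * (3 * L - dist z w)) :=
      mul_nonneg Real.pi_pos.le (mul_nonneg (sq_nonneg _) (by linarith))
    linarith [key, hmono]
  · rw [averaging_volumeReal_closedBall z hL]
    have key : 0 ≤ Real.pi * (L ^ 2 * (3 * dist z w - L)) :=
      mul_nonneg Real.pi_pos.le (mul_nonneg (sq_nonneg _) (by linarith))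
    linarith [key, hI]

/-- **Pair bound.** For two points `z, w` at distance `r`:
`vol(B(z,L) ∩ B(w,L)) · V_LJ(r) ≤ (4/3)πL³ · V_LJ(r) + (2π/3)L² r⁻⁵`, from the lens bound and
the attractive tail `V_LJ(r) ≥ −r⁻⁶/6` (trivial for `z = w`, where `V_LJ(0) = 0`). [folklore] -/
private theorem averaging_pair (z w : E3) {L : ℝ} (hL : 0 ≤ L) :
    volume.real (closedBall z L ∩ closedBall w L) * lennardJones (dist z w) ≤
      4 / 3 * Real.pi * L ^ 3 * lennardJones (dist z w) +
        2 * Real.pi / 3 * L ^ 2 * (dist z w)⁻¹ ^ 5 := by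
  rcases eq_or_ne z w with rfl | hzw
  · simp [lennardJones_zero]
  set r := dist z w with hr_def
  have hr : 0 < r := dist_pos.2 hzw
  set I := volume.real (closedBall z L ∩ closedBall w L) with hI_def
  have hIle : I ≤ 4 / 3 * Real.pi * L ^ 3 := by
    rw [← averaging_volumeReal_closedBall z hL]
    exact measureReal_mono Set.inter_subset_left measure_closedBall_lt_top.ne
  have hlens : 4 / 3 * Real.pi * L ^ 3 - I ≤ 4 * Real.pi * L ^ 2 * r := by
    have := averaging_lens z w hL
    rwa [averaging_volumeReal_closedBall z hL] at this
  have hV : -(1 / 6 * r⁻¹ ^ 6) ≤ lennardJones r := neg_le_lennardJones_of_le hr le_rfl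
  have h65 : 1 / 6 * r⁻¹ ^ 6 * (4 * Real.pi * L ^ 2 * r) = 2 * Real.pi / 3 * L ^ 2 * r⁻¹ ^ 5 := by
    have hr0 : r ≠ 0 := hr.ne'
    field_simp
    ring
  rcases le_or_gt 0 (lennardJones r) with hV0 | hV0
  · have h1 : I * lennardJones r ≤ 4 / 3 * Real.pi * L ^ 3 * lennardJones r :=
      mul_le_mul_of_nonneg_right hIle hV0
    have h2 : 0 ≤ 2 * Real.pi / 3 * L ^ 2 * r⁻¹ ^ 5 := by positivity
    linarith
  · have h1 : -lennardJones r * (4 / 3 * Real.pi * L ^ 3 - I) ≤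
        1 / 6 * r⁻¹ ^ 6 * (4 * Real.pi * L ^ 2 * r) :=
      mul_le_mul (by linarith) hlens (by linarith) (by positivity)
    linarith [h1, h65]

/-! ### The shell sum with exponent `5` -/

/-- **Shell sum, fifth power.** If all mutual distances in the configuration `x` (in `ℝ³`) are
`≥ r > 0`, then `∑_k |xᵢ − x_k|⁻⁵ ≤ 250 · r⁻⁵` (the diagonal term is `0⁻⁵ = 0`): the shell
`⌊|xᵢ − x_k| / r⌋ = b` (`b ≥ 1`) holds at most `(2b + 3)³ ≤ 125 b³` particles by the packing
bound, each contributing `≤ (b r)⁻⁵`, and `∑_{b ≥ 1} b⁻² ≤ 2`. [folklore] -/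
theorem averaging_sum_inv_pow_five_le {N : ℕ} (x : Fin N → E3) {r : ℝ} (hr : 0 < r)
    (hsep : ∀ k l, k ≠ l → r ≤ dist (x k) (x l)) (i : Fin N) :
    ∑ k, (dist (x i) (x k))⁻¹ ^ 5 ≤ 250 * r⁻¹ ^ 5 := by
  -- adapted from `Literature.MathematicalPhysics.StatisticalMechanics.sum_inv_pow_six_le` (6 → 5)
  rw [← Finset.add_sum_erase _ _ (Finset.mem_univ i), dist_self, inv_zero,
    zero_pow (by norm_num), zero_add]
  set s := Finset.univ.erase i with hs_def
  set m : Fin N → ℕ := fun k => ⌊dist (x i) (x k) / r⌋₊ with hm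
  set t := s.image m with ht_def
  have hmem : ∀ k ∈ s, m k ∈ t := fun k hk => Finset.mem_image_of_mem m hk
  have hks : ∀ k ∈ s, r ≤ dist (x i) (x k) := fun k hk =>
    hsep i k (Finset.ne_of_mem_erase hk).symm
  have hm1 : ∀ k ∈ s, 1 ≤ m k := fun k hk =>
    (Nat.one_le_floor_iff _).2 ((one_le_div hr).2 (hks k hk))
  have hmle : ∀ k ∈ s, r * m k ≤ dist (x i) (x k) := fun k hk => by
    have := Nat.floor_le (div_nonneg dist_nonneg hr.le : 0 ≤ dist (x i) (x k) / r)
    rwa [le_div_iff₀ hr, mul_comm] at this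
  have hmlt : ∀ k ∈ s, dist (x i) (x k) < (m k + 1) * r := fun k hk => by
    have := Nat.lt_floor_add_one (dist (x i) (x k) / r)
    rwa [div_lt_iff₀ hr] at this
  -- termwise: `|xᵢ - x_k|⁻⁵ ≤ (r m_k)⁻⁵`
  have step1 : ∑ k ∈ s, (dist (x i) (x k))⁻¹ ^ 5 ≤ ∑ k ∈ s, r⁻¹ ^ 5 * ((m k : ℝ))⁻¹ ^ 5 := by
    refine Finset.sum_le_sum fun k hk => ?_
    rw [← mul_pow, ← mul_inv]
    have h0 : 0 < r * m k := mul_pos hr (by exact_mod_cast hm1 k hk)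
    exact pow_le_pow_left₀ (inv_nonneg.2 dist_nonneg) (inv_anti₀ h0 (hmle k hk)) _
  -- regroup by shells
  have step2 : ∑ k ∈ s, r⁻¹ ^ 5 * ((m k : ℝ))⁻¹ ^ 5 =
      ∑ b ∈ t, ((s.filter fun k => m k = b).card : ℝ) * (r⁻¹ ^ 5 * ((b : ℝ))⁻¹ ^ 5) := by
    have := Finset.sum_fiberwise_of_maps_to' hmem (fun b : ℕ => r⁻¹ ^ 5 * ((b : ℝ))⁻¹ ^ 5)
    simp only [Finset.sum_const, nsmul_eq_mul] at this
    exact this.symm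
  -- each shell holds at most `(2b+3)³` particles
  have step3 : ∀ b ∈ t, ((s.filter fun k => m k = b).card : ℝ) ≤ (2 * (b : ℝ) + 3) ^ 3 := by
    intro b hb
    set F := s.filter fun k => m k = b with hF
    have hinj : Set.InjOn x F := fun k _ l _ hkl => by
      by_contra hne
      have := hsep k l hne
      rw [hkl, dist_self] at this
      exact absurd this (not_le.2 hr)
    rw [← Finset.card_image_of_injOn hinj]
    have hR : (0 : ℝ) ≤ ((b : ℝ) + 1) * r := by positivity
    have := card_le_of_separated_of_dist_le (F.image x) (x i) hr hR ?_ ?_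
    · rw [finrank_euclideanSpace_fin] at this
      convert this using 2
      field_simp
      ring
    · intro c hc
      obtain ⟨k, hk, rfl⟩ := Finset.mem_image.1 hc
      obtain ⟨hks', hkb⟩ := Finset.mem_filter.1 hk
      rw [dist_comm]
      have := hmlt k hks'
      rw [hkb] at this
      exact this.le
    · intro c hc c' hc' hne
      obtain ⟨k, -, rfl⟩ := Finset.mem_image.1 hc
      obtain ⟨l, -, rfl⟩ := Finset.mem_image.1 hc'
      exact hsep k l fun h => hne (h ▸ rfl)
  -- numerics per shell: `(2b+3)³ b⁻⁵ ≤ 125 b⁻²` for `b ≥ 1`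
  have step4 : ∀ b ∈ t, (2 * (b : ℝ) + 3) ^ 3 * (r⁻¹ ^ 5 * ((b : ℝ))⁻¹ ^ 5) ≤
      125 * r⁻¹ ^ 5 * ((b : ℝ) ^ 2)⁻¹ := by
    intro b hb
    obtain ⟨k, hk, rfl⟩ := Finset.mem_image.1 hb
    have hb1 : (1 : ℝ) ≤ (m k : ℝ) := by exact_mod_cast hm1 k hk
    set β : ℝ := (m k : ℝ)
    have hβ : 0 < β := by linarith
    have hr5 : 0 < r⁻¹ ^ 5 := by positivity
    have key : (2 * β + 3) ^ 3 * (β⁻¹) ^ 5 ≤ 125 * (β ^ 2)⁻¹ := by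
      rw [inv_pow, ← div_eq_mul_inv, ← div_eq_mul_inv,
        div_le_div_iff₀ (by positivity) (by positivity)]
      have h5 : (2 * β + 3) ^ 3 ≤ (5 * β) ^ 3 :=
        pow_le_pow_left₀ (by positivity) (by linarith) 3
      nlinarith [mul_le_mul_of_nonneg_right h5 (sq_nonneg β)]
    calc (2 * β + 3) ^ 3 * (r⁻¹ ^ 5 * (β⁻¹) ^ 5) = r⁻¹ ^ 5 * ((2 * β + 3) ^ 3 * (β⁻¹) ^ 5) := by
          ring
      _ ≤ r⁻¹ ^ 5 * (125 * (β ^ 2)⁻¹) := mul_le_mul_of_nonneg_left key hr5.le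
      _ = 125 * r⁻¹ ^ 5 * (β ^ 2)⁻¹ := by ring
  -- `∑_{b ∈ t} b⁻² ≤ 2`
  have step5 : ∑ b ∈ t, ((b : ℝ) ^ 2)⁻¹ ≤ 2 := by
    have hsub : t ⊆ Finset.Ioo 0 (t.sup id + 1) := fun b hb => by
      rw [Finset.mem_Ioo]
      obtain ⟨k, hk, rfl⟩ := Finset.mem_image.1 hb
      exact ⟨hm1 k hk, Nat.lt_succ_of_le (Finset.le_sup (f := id) hb)⟩
    have h2 := sum_Ioo_inv_sq_le (α := ℝ) 0 (t.sup id + 1)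
    calc ∑ b ∈ t, ((b : ℝ) ^ 2)⁻¹ ≤ ∑ b ∈ Finset.Ioo 0 (t.sup id + 1), ((b : ℝ) ^ 2)⁻¹ :=
          Finset.sum_le_sum_of_subset_of_nonneg hsub fun b _ _ => by positivity
      _ ≤ 2 := by simpa using h2
  calc ∑ k ∈ s, (dist (x i) (x k))⁻¹ ^ 5
      ≤ ∑ b ∈ t, ((s.filter fun k => m k = b).card : ℝ) * (r⁻¹ ^ 5 * ((b : ℝ))⁻¹ ^ 5) :=
        step1.trans_eq step2
    _ ≤ ∑ b ∈ t, (2 * (b : ℝ) + 3) ^ 3 * (r⁻¹ ^ 5 * ((b : ℝ))⁻¹ ^ 5) :=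
        Finset.sum_le_sum fun b hb => mul_le_mul_of_nonneg_right (step3 b hb) (by positivity)
    _ ≤ ∑ b ∈ t, 125 * r⁻¹ ^ 5 * ((b : ℝ) ^ 2)⁻¹ := Finset.sum_le_sum step4
    _ = 125 * r⁻¹ ^ 5 * ∑ b ∈ t, ((b : ℝ) ^ 2)⁻¹ := by rw [Finset.mul_sum]
    _ ≤ 125 * r⁻¹ ^ 5 * 2 := mul_le_mul_of_nonneg_left step5 (by positivity)
    _ = 250 * r⁻¹ ^ 5 := by ring

/-! ### The averaging integrals -/

/-- **Averaging integrals over ball centres.** For a `δ`-separated injective configuration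
`x : Fin N → ℝ³` and `L ≥ 1`, the ball count `c ↦ #{j : |x_j − c| ≤ L}`, the shell count
`c ↦ #{j : L − 1 < |x_j − c| ≤ L + 1}` and the ball energy
`c ↦ Σ_{j ≠ k} 1[|x_j − c| ≤ L, |x_k − c| ≤ L] V_LJ(|x_j − x_k|)` are integrable over `c ∈ ℝ³`, with
`∫ #B_L(c) dc = N · (4/3)πL³`, `∫ #shell ≤ 11πL²N` and
`∫ E_int(B_L(c)) dc ≤ (4/3)πL³ · 2𝓔(x) + 530 δ⁻⁵ L² N` (finite sums of indicators of balls,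
shells and lenses; the lens defect `≤ 4πL²r` is paid against the attractive tail `r⁻⁶/6` and
summed with the shell sum `Σ r⁻⁵ ≤ 250 δ⁻⁵`, `500π/3 ≤ 530`). [folklore] -/
theorem averagingIntegrals :
    ∀ (N : ℕ) (x : Fin N → E3) (δ L : ℝ), 0 < δ → 1 ≤ L → Function.Injective x →
      (∀ j k : Fin N, j ≠ k → δ ≤ dist (x j) (x k)) →
      Integrable (fun c : E3 => ((Finset.univ.filter fun j : Fin N => dist (x j) c ≤ L).card : ℝ)) ∧
      Integrable (fun c : E3 =>
        ((Finset.univ.filter fun j : Fin N => L - 1 < dist (x j) c ∧ dist (x j) c ≤ L + 1).card : ℝ)) ∧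
      Integrable (fun c : E3 => ∑ j : Fin N, ∑ k : Fin N,
        if j ≠ k ∧ dist (x j) c ≤ L ∧ dist (x k) c ≤ L then lennardJones (dist (x j) (x k)) else 0) ∧
      (∫ c : E3, ((Finset.univ.filter fun j : Fin N => dist (x j) c ≤ L).card : ℝ)) =
        N * (4 / 3 * Real.pi * L ^ 3) ∧
      (∫ c : E3,
        ((Finset.univ.filter fun j : Fin N => L - 1 < dist (x j) c ∧ dist (x j) c ≤ L + 1).card : ℝ)) ≤
        11 * Real.pi * L ^ 2 * N ∧
      (∫ c : E3, ∑ j : Fin N, ∑ k : Fin N,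
        if j ≠ k ∧ dist (x j) c ≤ L ∧ dist (x k) c ≤ L then lennardJones (dist (x j) (x k)) else 0) ≤
        (4 / 3 * Real.pi * L ^ 3) * (2 * interactionEnergy lennardJones x) + 530 * δ⁻¹ ^ 5 * L ^ 2 * N := by
  intro N x δ L hδ hL hx hsep
  have hL0 : 0 ≤ L := zero_le_one.trans hL
  have hL1 : 0 ≤ L - 1 := sub_nonneg.2 hL
  -- constants times indicators of measurable subsets of balls are integrable
  have hInt : ∀ (z : E3) (ρ : ℝ) (s : Set E3) (a : ℝ), s ⊆ closedBall z ρ → MeasurableSet s →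
      Integrable (s.indicator fun _ : E3 => a) volume := fun z ρ s a hs hm =>
    (integrableOn_const (measure_ne_top_of_subset hs measure_closedBall_lt_top.ne)).integrable_indicator
      hm
  -- (1) the ball count is a sum of indicators of balls
  have h1 : (fun c : E3 => ((Finset.univ.filter fun j : Fin N => dist (x j) c ≤ L).card : ℝ)) =
      fun c => ∑ j, (closedBall (x j) L).indicator (fun _ => (1 : ℝ)) c := by
    funext c
    rw [Finset.natCast_card_filter]
    refine Finset.sum_congr rfl fun j _ => ?_
    by_cases h : dist (x j) c ≤ L
    · rw [if_pos h, Set.indicator_of_mem (mem_closedBall'.2 h)]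
    · rw [if_neg h, Set.indicator_of_notMem (fun h' => h (mem_closedBall'.1 h'))]
  have hI1 : ∀ j : Fin N, Integrable ((closedBall (x j) L).indicator fun _ : E3 => (1 : ℝ)) volume :=
    fun j => hInt (x j) L _ 1 subset_rfl measurableSet_closedBall
  -- (2) the shell count is a sum of indicators of shells
  have hmem2 : ∀ (j : Fin N) (c : E3), c ∈ closedBall (x j) (L + 1) \ closedBall (x j) (L - 1) ↔
      L - 1 < dist (x j) c ∧ dist (x j) c ≤ L + 1 := fun j c => by
    rw [Set.mem_sdiff, mem_closedBall', mem_closedBall', not_le]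
    exact ⟨fun h => ⟨h.2, h.1⟩, fun h => ⟨h.2, h.1⟩⟩
  have h2 : (fun c : E3 =>
      ((Finset.univ.filter fun j : Fin N => L - 1 < dist (x j) c ∧ dist (x j) c ≤ L + 1).card : ℝ)) =
      fun c => ∑ j, (closedBall (x j) (L + 1) \ closedBall (x j) (L - 1)).indicator
        (fun _ => (1 : ℝ)) c := by
    funext c
    rw [Finset.natCast_card_filter]
    refine Finset.sum_congr rfl fun j _ => ?_
    by_cases h : L - 1 < dist (x j) c ∧ dist (x j) c ≤ L + 1
    · rw [if_pos h, Set.indicator_of_mem ((hmem2 j c).2 h)]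
    · rw [if_neg h, Set.indicator_of_notMem (fun h' => h ((hmem2 j c).1 h'))]
  have hS : ∀ j : Fin N, MeasurableSet (closedBall (x j) (L + 1) \ closedBall (x j) (L - 1)) :=
    fun j => measurableSet_closedBall.diff measurableSet_closedBall
  have hI2 : ∀ j : Fin N, Integrable
      ((closedBall (x j) (L + 1) \ closedBall (x j) (L - 1)).indicator fun _ : E3 => (1 : ℝ)) volume :=
    fun j => hInt (x j) (L + 1) _ 1 Set.sdiff_subset (hS j)
  have hvol2 : ∀ j : Fin N, volume.real (closedBall (x j) (L + 1) \ closedBall (x j) (L - 1)) =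
      4 / 3 * Real.pi * (L + 1) ^ 3 - 4 / 3 * Real.pi * (L - 1) ^ 3 := fun j => by
    rw [measureReal_sdiff (closedBall_subset_closedBall (by linarith)) measurableSet_closedBall
      measure_closedBall_lt_top.ne, averaging_volumeReal_closedBall _ (by linarith),
      averaging_volumeReal_closedBall _ hL1]
  -- (3) the ball energy is a sum of constants times indicators of lenses
  have hmem3 : ∀ (j k : Fin N) (c : E3), c ∈ closedBall (x j) L ∩ closedBall (x k) L ↔
      dist (x j) c ≤ L ∧ dist (x k) c ≤ L := fun j k c => by
    rw [Set.mem_inter_iff, mem_closedBall', mem_closedBall']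
  have h3 : (fun c : E3 => ∑ j : Fin N, ∑ k : Fin N,
      if j ≠ k ∧ dist (x j) c ≤ L ∧ dist (x k) c ≤ L then lennardJones (dist (x j) (x k)) else 0) =
      fun c => ∑ j, ∑ k, (closedBall (x j) L ∩ closedBall (x k) L).indicator
        (fun _ => lennardJones (dist (x j) (x k))) c := by
    funext c
    refine Finset.sum_congr rfl fun j _ => Finset.sum_congr rfl fun k _ => ?_
    by_cases hjk : j = k
    · subst hjk
      rw [if_neg (fun h => h.1 rfl), dist_self, lennardJones_zero, Set.indicator_zero]
    · by_cases h : dist (x j) c ≤ L ∧ dist (x k) c ≤ L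
      · rw [if_pos ⟨hjk, h⟩, Set.indicator_of_mem ((hmem3 j k c).2 h)]
      · rw [if_neg (fun h' => h h'.2), Set.indicator_of_notMem (fun h' => h ((hmem3 j k c).1 h'))]
  have hT : ∀ j k : Fin N, MeasurableSet (closedBall (x j) L ∩ closedBall (x k) L) :=
    fun j k => measurableSet_closedBall.inter measurableSet_closedBall
  have hI3 : ∀ j k : Fin N, Integrable ((closedBall (x j) L ∩ closedBall (x k) L).indicator
      fun _ : E3 => lennardJones (dist (x j) (x k))) volume :=
    fun j k => hInt (x j) L _ _ Set.inter_subset_left (hT j k)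
  refine ⟨?_, ?_, ?_, ?_, ?_, ?_⟩
  · rw [h1]
    exact integrable_finsetSum _ fun j _ => hI1 j
  · rw [h2]
    exact integrable_finsetSum _ fun j _ => hI2 j
  · rw [h3]
    exact integrable_finsetSum _ fun j _ => integrable_finsetSum _ fun k _ => hI3 j k
  · rw [h1, integral_finsetSum _ fun j _ => hI1 j]
    simp_rw [integral_indicator_const _ measurableSet_closedBall,
      averaging_volumeReal_closedBall _ hL0, smul_eq_mul, mul_one, Finset.sum_const,
      Finset.card_univ, Fintype.card_fin, nsmul_eq_mul]
  · rw [h2, integral_finsetSum _ fun j _ => hI2 j]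
    have hint : ∀ j : Fin N,
        ∫ c, (closedBall (x j) (L + 1) \ closedBall (x j) (L - 1)).indicator (fun _ => (1 : ℝ)) c =
          4 / 3 * Real.pi * (L + 1) ^ 3 - 4 / 3 * Real.pi * (L - 1) ^ 3 := fun j => by
      rw [integral_indicator_const _ (hS j), hvol2 j, smul_eq_mul, mul_one]
    simp_rw [hint, Finset.sum_const, Finset.card_univ, Fintype.card_fin, nsmul_eq_mul]
    have key : 0 ≤ (N : ℝ) * (Real.pi * (3 * L ^ 2 - 8 / 3)) :=
      mul_nonneg N.cast_nonneg (mul_nonneg Real.pi_pos.le (by nlinarith))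
    linarith [key]
  · rw [h3, integral_finsetSum _ fun j _ => integrable_finsetSum _ fun k _ => hI3 j k]
    have hint : ∀ j : Fin N, ∫ c, ∑ k, (closedBall (x j) L ∩ closedBall (x k) L).indicator
        (fun _ => lennardJones (dist (x j) (x k))) c =
        ∑ k, volume.real (closedBall (x j) L ∩ closedBall (x k) L) * lennardJones (dist (x j) (x k)) :=
      fun j => by
      rw [integral_finsetSum _ fun k _ => hI3 j k]
      refine Finset.sum_congr rfl fun k _ => ?_
      rw [integral_indicator_const _ (hT j k), smul_eq_mul]
    simp_rw [hint]
    have hpair : ∀ j k : Fin N,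
        volume.real (closedBall (x j) L ∩ closedBall (x k) L) * lennardJones (dist (x j) (x k)) ≤
          4 / 3 * Real.pi * L ^ 3 * lennardJones (dist (x j) (x k)) +
            2 * Real.pi / 3 * L ^ 2 * (dist (x j) (x k))⁻¹ ^ 5 :=
      fun j k => averaging_pair (x j) (x k) hL0
    have hshell : ∀ j : Fin N, ∑ k, (dist (x j) (x k))⁻¹ ^ 5 ≤ 250 * δ⁻¹ ^ 5 := fun j =>
      averaging_sum_inv_pow_five_le x hδ hsep j
    calc ∑ j, ∑ k, volume.real (closedBall (x j) L ∩ closedBall (x k) L) *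
          lennardJones (dist (x j) (x k))
        ≤ ∑ j, ∑ k, (4 / 3 * Real.pi * L ^ 3 * lennardJones (dist (x j) (x k)) +
            2 * Real.pi / 3 * L ^ 2 * (dist (x j) (x k))⁻¹ ^ 5) :=
          Finset.sum_le_sum fun j _ => Finset.sum_le_sum fun k _ => hpair j k
      _ = 4 / 3 * Real.pi * L ^ 3 * (2 * interactionEnergy lennardJones x) +
            2 * Real.pi / 3 * L ^ 2 * ∑ j, ∑ k, (dist (x j) (x k))⁻¹ ^ 5 := by
          rw [two_mul_interactionEnergy_eq_sum_sum lennardJones lennardJones_zero x]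
          simp only [Finset.sum_add_distrib, Finset.mul_sum]
      _ ≤ 4 / 3 * Real.pi * L ^ 3 * (2 * interactionEnergy lennardJones x) +
            2 * Real.pi / 3 * L ^ 2 * ∑ j : Fin N, (250 * δ⁻¹ ^ 5 : ℝ) := by
          gcongr with j _
          exact hshell j
      _ ≤ 4 / 3 * Real.pi * L ^ 3 * (2 * interactionEnergy lennardJones x) +
            530 * δ⁻¹ ^ 5 * L ^ 2 * N := by
          rw [Finset.sum_const, Finset.card_univ, Fintype.card_fin, nsmul_eq_mul]
          have key : 0 ≤ (530 - 500 * Real.pi / 3) * (δ⁻¹ ^ 5 * L ^ 2 * N) :=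
            mul_nonneg (by linarith [Real.pi_lt_d2]) (by positivity)
          linarith [key]

end Summit.AtomisticToContinuum.Crystallization.Theorems.LjLaminarWindowsSketch

end
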